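import Summits.Langlands.Langlands.Theorems.IrreducibilityBySelfDualityHeckeEigenvalueFieldResConeClean
import Summits.Langlands.Langlands.Theorems.IrreducibilityBySelfDualityHeckeEigenvalueFieldResFinal
import Summits.Langlands.Langlands.Theorems.IrreducibilityBySelfDualityHeckeEigenvalueFieldResGlOneCharacter
import Summits.Langlands.Langlands.Theorems.IrreducibilityBySelfDualityHeckeEigenvalueFieldResGlOneEigenclass
import Summits.Langlands.Langlands.Theorems.IrreducibilityBySelfDualityHeckeEigenvalueFieldStubConeEquivariant
import Summits.Langlands.Langlands.Theorems.IrreducibilityBySelfDualityHeckeEigenvalueFieldStubConeHecke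
import Summits.Langlands.Langlands.Theorems.IrreducibilityBySelfDualityHeckeEigenvalueFieldResConeAnalytic
import Literature.NumberTheory.Automorphic.ResGLnCuspidalCohomologyApex
import Literature.NumberTheory.Automorphic.ResGLnCuspidalEigenclass
import Summits.Langlands.Langlands.Theses.IrreducibilityBySelfDuality
import HarnessLib

/-!
# `HeckeEigenvalueField` (Clozel 1990, Thm. 3.13: the Hecke field) for `GL_n` over ANY number field,
# from the two named apex facts of the Borel–Wallach dictionary — line `Sketch`, lead c8

Sub-problem `Langlands`, crux item stmt-Langlands-13632, route `IrreducibilityBySelfDuality`; namespace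
`Summit.Langlands.Langlands.Theorems.HeckeEigenvalueField.Res` (that of the landed pieces of the line).

The line `Sketch` realises a regular algebraic cuspidal `π` in the Betti cohomology
`H^•(GL_n(K)⁺, Fun(GL_n(𝔸_K^∞)/K_f(𝔫), E_λ))` of the arithmetic quotients of `Res_{K/ℚ} GL_n` through the
Borel–Wallach dictionary in the cone model [cite: BorelWallach2000, VII 2.2–2.7]: a level-fixed
`(𝔤, K_∞)`-cocycle `η` with values in `π.W ⊗ (E_λ ⊗ ε_S)` gives the equivariant family of closed forms
`ω(η) = ConeDictionary.coneForm π S λ η` on the positive hermitian cone (`…ResConeAnalytic`, p139794;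
`…StubConeEquivariant`, p139189), a Hecke eigenfamily with the eigenvalues of `π^{K(𝔫)}`
(`…StubConeHecke`, p139493), whose cone class (`TwistedQuotient.coneClass`, Dupont / van Est) is the
sought eigenclass; the Gelfand–Piatetski-Shapiro step reduces arbitrary cuspidal data to clean data
(`…ResConeClean`, p130591); Borel–Serre finite-dimensionality (`…BorelSerre`, p127282), the comparison
with the Satake eigenvalues (`…ResComparison`, p120016) and the rank-one case (`…ResGlOneCharacter`,
`…ResGlOneEigenclass`) are theorems of the tree.  What is NOT in the tree are the two archimedean /
analytic inputs, now the named facts of `Literature.NumberTheory.Automorphic.ResGLnCuspidalCohomologyApex`: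

* (a′) `ConeDictionary.Clozel1990_exists_basic_levelFixed_cocycle` — Clozel's Lemme 3.14 (with
  Borel–Wallach I 1.3, III 5.1): a clean cohomological cuspidal `π`, `n ≥ 2`, has a basic level-fixed
  non-cobounding cocycle [cite: Clozel1990, Lemme 3.14 and §3.5 (pp. 120–123)];
* (c′) `ConeDictionary.Borel1983_coneClass_ne_zero` — Borel's injectivity of cuspidal
  `(𝔪_G, K_∞)`-cohomology, through the cone periods [cite: Borel1983Regularization, Thm. 5.3 and Cor. 5.5].

THIS FILE proves, CONDITIONALLY on these two facts (hypotheses `ha`, `hc`; D-0014 conditional result):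
`coneEigenfamily_clean_of_apexFacts` (the registered composition stub CONE-CLEAN of the skeleton
`Cruxes/HeckeEigenvalueField/Lines/Sketch.lean`), `coneEigenfamily_rank_two_of_apexFacts`,
`eigenformComparison_rank_two_of_apexFacts`, `cuspidalEigenclass_exists_of_apexFacts` (the named fact
`ResGLnCohomology.cuspidalEigenclass_exists`, ALL `n ≥ 1`, from (a′) and (c′)),
`clozel1990_heckeEigenvalueField_of_apexFacts` (the Literature named fact `Clozel1990_heckeEigenvalueField`)
and `heckeEigenvalueField_of_apexFacts : (a′) → (c′) → HeckeEigenvalueField` (the crux BY NAME, through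
`route_heckeEigenvalueField_of_clozel1990` of `…Conditional`).

## References

* L. Clozel, *Motifs et formes automorphes* (1990), Thm. 3.13, Lemme 3.14–3.15, §3.5. [Clozel1990]
* A. Borel, Duke Math. J. 50 (1983), Thm. 5.3, Cor. 5.5. [Borel1983Regularization]
* A. Borel, N. Wallach, *Continuous cohomology …*, 2nd ed. (2000), VII 2.2–2.7. [BorelWallach2000]
* A. Borel, J-P. Serre, *Corners and arithmetic groups* (1973), §11. [BorelSerre1973]
-/

set_option linter.dupNamespace false -- project-wide: `Summit.Langlands.Langlands` is the mandated namespace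

noncomputable section

open scoped Classical Pointwise ComplexOrder Matrix
open Filter NumberField NumberField.mixedEmbedding IsDedekindDomain CategoryTheory
open Literature.NumberTheory.Automorphic Literature.NumberTheory.DiophantineGeometry
  Literature.Barriers.Langlands Literature.Algebra.Homology

namespace Summit.Langlands.Langlands.Theorems.HeckeEigenvalueField.Res

open ResGLnCohomology BigHeckeGLn

/-- **CONE-CLEAN from the two apex facts** (the registered composition of the skeleton, v15): take the
basic level-fixed cocycle `η` of (a′), the family `ω := ConeDictionary.coneForm π S λ η` in degree
`q + 1`, the structure theorem `stub_coneForm_isConeFormFamily` fed with the equivariance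
`stub_coneForm_equivariant`, the non-vanishing (c′) and the Hecke identity `stub_coneForm_hecke`.
[cite: BorelWallach2000, VII 2.2–2.7] [cite: Clozel1990, Lemme 3.14, Lemme 3.15 and §3.5 (pp. 120–123)]
[cite: Borel1983Regularization, Thm. 5.3 and Cor. 5.5] -/
theorem coneEigenfamily_clean_of_apexFacts
    (ha : ConeDictionary.Clozel1990_exists_basic_levelFixed_cocycle)
    (hc : ConeDictionary.Borel1983_coneClass_ne_zero) :
    ∀ (n : ℕ) (K : Type) [Field K] [NumberField K] (hcpt : isCompact_glFiniteIntegralLevel n K)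
      (𝔫 : Ideal (𝓞 K)) (lam : (K →+* ℂ) → Fin n → ℤ), 2 ≤ n → 𝔫 ≠ 0 →
      (∀ τ, Weight.IsDominant (lam τ)) →
      ∀ π : CuspidalAutomorphicRepData n K hcpt, π.1.W' = ⊥ →
        (∃ μ : ℂ, ∀ c ∈ π.1.W, lieDeriv (AutomorphyDatum.gl n K hcpt).ofArch
          (⟨1, trivial⟩ : (AutomorphyDatum.gl n K hcpt).arch.lie) c = μ • c) →
        (∃ T : InfinityType K n, π.1.HasInfinityType T ∧
          ∀ τ : K →+* ℂ, (T τ).map ArchWeight.a =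
            (cohomologicalInfinityType n K (Weight.dual (lam τ)) τ).map ArchWeight.a) →
        (∃ φ ∈ π.1.W, φ ≠ 0 ∧
          ∀ u ∈ principalCongruenceLevel n K 𝔫, rightTranslation (AdelicGroupData.gl n K) u φ = φ) →
        ∀ c : HeightOneSpectrum (𝓞 K) → ℕ → ℂ,
          (∀ v : HeightOneSpectrum (𝓞 K), ¬ v.asIdeal ∣ 𝔫 → ∀ i ≤ n, ∀ ψ ∈ π.1.W,
            (∀ u ∈ principalCongruenceLevel n K 𝔫, rightTranslation (AdelicGroupData.gl n K) u ψ = ψ) →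
            heckeOperator (rightTranslation (AdelicGroupData.gl n K))
                (principalCongruenceLevel n K 𝔫)
                (heckeDiagAt n K v (uniformizerAt v) i) ψ = c v i • ψ) →
          ∃ (q : ℕ) (ω : FiniteAdelicGL n K → ResGLnCone.hermSpace n K →
              (ResGLnCone.hermSpace n K) [⋀^Fin q]→L[ℝ] CoeffModule ℂ n K lam)
            (hω : TwistedQuotient.IsConeFormFamily (diagPos n K) (level n K 𝔫)
              (coeffRepPos ℂ n K lam)
              ((ResGLnCone.coneActionRat n K).comp (glTotPos n K).subtype)
              (ResGLnCone.posCone n K) ω),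
            TwistedQuotient.coneClass hω (ResGLnCone.hermOne_mem_posCone n K) ≠ 0 ∧
            ∀ v : HeightOneSpectrum (𝓞 K), ¬ v.asIdeal ∣ 𝔫 → ∀ i ≤ n,
              ∀ (cL : FiniteAdelicGL n K ⧸ level n K 𝔫), ∀ y ∈ ResGLnCone.posCone n K,
                ∀ vec : Fin q → ResGLnCone.hermSpace n K,
                  ArithmeticQuotient.heckeFun ℂ (level n K 𝔫) (heckeElement n K v i)
                    (CoeffModule ℂ n K lam) (fun c' => ω c'.out y vec) cL = c v i • ω cL.out y vec := by
  intro n K _ _ hcpt 𝔫 lam hn h𝔫 hdom π hbot hμ hT hfixφ c hcv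
  obtain ⟨S, q, η, hη, hfix, hZ, hnot⟩ := ha n K hcpt 𝔫 lam hn h𝔫 hdom π hbot hμ hT hfixφ
  have hmem : η ∈ (ConeDictionary.gkComplexLS π.1 S lam).carrier (q + 1) :=
    (((ConeDictionary.gkComplexLS π.1 S lam).mem_cocycles_iff (q + 1) η).1 hη).1
  have hω := stub_coneForm_isConeFormFamily hcpt 𝔫 π.1 S lam hη hfix
    (fun γ c' H hH v => stub_coneForm_equivariant hcpt π.1 S lam hmem γ c' hH v)
  refine ⟨q + 1, fun c' H => ConeDictionary.coneForm π.1 S lam η c' H, hω,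
    hc n K hcpt 𝔫 π hbot hμ S lam hdom q η hη hfix hZ hnot hω, ?_⟩
  intro v hv i hi cL y _ vec
  exact stub_coneForm_hecke hcpt 𝔫 h𝔫 π hbot S lam η hfix c hcv hv hi cL y vec

/-- **CONE (rank ≥ 2) for arbitrary cuspidal data from the apex facts**, through the landed
Gelfand–Piatetski-Shapiro step `coneEigenfamily_rank_two_of_clean` (`…ResConeClean`).
[cite: BorelJacquetCorvallis1979, §4.6 and 5.7] [cite: Clozel1990, §3.5 (p. 123)] -/
theorem coneEigenfamily_rank_two_of_apexFacts
    (ha : ConeDictionary.Clozel1990_exists_basic_levelFixed_cocycle)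
    (hc : ConeDictionary.Borel1983_coneClass_ne_zero) :
    ∀ (n : ℕ) (K : Type) [Field K] [NumberField K] (hcpt : isCompact_glFiniteIntegralLevel n K)
      (𝔫 : Ideal (𝓞 K)) (lam : (K →+* ℂ) → Fin n → ℤ), 2 ≤ n → 𝔫 ≠ 0 →
      (∀ τ, Weight.IsDominant (lam τ)) →
      ∀ π : CuspidalAutomorphicRepData n K hcpt,
        (∃ T : InfinityType K n, π.1.HasInfinityType T ∧
          ∀ τ : K →+* ℂ, (T τ).map ArchWeight.a =
            (cohomologicalInfinityType n K (Weight.dual (lam τ)) τ).map ArchWeight.a) →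
        ∀ φ ∈ π.1.W, φ ∉ π.1.W' →
          (∀ u ∈ principalCongruenceLevel n K 𝔫,
            rightTranslation (AdelicGroupData.gl n K) u φ = φ) →
          ∀ c : HeightOneSpectrum (𝓞 K) → ℕ → ℂ,
            (∀ v : HeightOneSpectrum (𝓞 K), ¬ v.asIdeal ∣ 𝔫 → ∀ i ≤ n,
              heckeOperator (rightTranslation (AdelicGroupData.gl n K))
                  (principalCongruenceLevel n K 𝔫)
                  (heckeDiagAt n K v (uniformizerAt v) i) φ - c v i • φ ∈ π.1.W') →
            ∃ (q : ℕ) (ω : FiniteAdelicGL n K → ResGLnCone.hermSpace n K →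
                (ResGLnCone.hermSpace n K) [⋀^Fin q]→L[ℝ] CoeffModule ℂ n K lam)
              (hω : TwistedQuotient.IsConeFormFamily (diagPos n K) (level n K 𝔫)
                (coeffRepPos ℂ n K lam)
                ((ResGLnCone.coneActionRat n K).comp (glTotPos n K).subtype)
                (ResGLnCone.posCone n K) ω),
              TwistedQuotient.coneClass hω (ResGLnCone.hermOne_mem_posCone n K) ≠ 0 ∧
              ∀ v : HeightOneSpectrum (𝓞 K), ¬ v.asIdeal ∣ 𝔫 → ∀ i ≤ n,
                ∀ (cL : FiniteAdelicGL n K ⧸ level n K 𝔫), ∀ y ∈ ResGLnCone.posCone n K,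
                  ∀ vec : Fin q → ResGLnCone.hermSpace n K,
                    ArithmeticQuotient.heckeFun ℂ (level n K 𝔫) (heckeElement n K v i)
                      (CoeffModule ℂ n K lam) (fun c' => ω c'.out y vec) cL = c v i • ω cL.out y vec :=
  coneEigenfamily_rank_two_of_clean (coneEigenfamily_clean_of_apexFacts ha hc)

/-- **A′ (rank ≥ 2) from the apex facts**: the cone class of the eigenfamily is the non-zero eigenclass
`x ∈ H^q(S_{K_f(𝔫)}, Ẽ_λ) = levelCohomology ℂ n K 𝔫 λ q`, and `T_{v,i} x = c_{v,i} x` is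
`TwistedQuotient.heckeEnd_coneClass_eq_smul`. [cite: BorelWallach2000, VII 2.5–2.7]
[cite: Clozel1990, Lemme 3.15 and §3.5 (pp. 120–123)] -/
theorem eigenformComparison_rank_two_of_apexFacts
    (ha : ConeDictionary.Clozel1990_exists_basic_levelFixed_cocycle)
    (hc : ConeDictionary.Borel1983_coneClass_ne_zero) :
    ∀ (n : ℕ) (K : Type) [Field K] [NumberField K] (hcpt : isCompact_glFiniteIntegralLevel n K)
      (𝔫 : Ideal (𝓞 K)) (lam : (K →+* ℂ) → Fin n → ℤ), 2 ≤ n → 𝔫 ≠ 0 →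
      (∀ τ, Weight.IsDominant (lam τ)) →
      ∀ π : CuspidalAutomorphicRepData n K hcpt,
        (∃ T : InfinityType K n, π.1.HasInfinityType T ∧
          ∀ τ : K →+* ℂ, (T τ).map ArchWeight.a =
            (cohomologicalInfinityType n K (Weight.dual (lam τ)) τ).map ArchWeight.a) →
        ∀ φ ∈ π.1.W, φ ∉ π.1.W' →
          (∀ u ∈ principalCongruenceLevel n K 𝔫,
            rightTranslation (AdelicGroupData.gl n K) u φ = φ) →
          ∀ c : HeightOneSpectrum (𝓞 K) → ℕ → ℂ,
            (∀ v : HeightOneSpectrum (𝓞 K), ¬ v.asIdeal ∣ 𝔫 → ∀ i ≤ n,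
              heckeOperator (rightTranslation (AdelicGroupData.gl n K))
                  (principalCongruenceLevel n K 𝔫)
                  (heckeDiagAt n K v (uniformizerAt v) i) φ - c v i • φ ∈ π.1.W') →
            ∃ (q : ℕ) (x : levelCohomology ℂ n K 𝔫 lam q), x ≠ 0 ∧
              ∀ v : HeightOneSpectrum (𝓞 K), ¬ v.asIdeal ∣ 𝔫 → ∀ i ≤ n,
                heckeT ℂ n K 𝔫 lam q v i x = c v i • x := by
  intro n K _ _ hcpt 𝔫 lam hn h𝔫 hdom π hT φ hφW hφW' hfix c hcv
  obtain ⟨q, ω, hω, hne, heig⟩ :=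
    coneEigenfamily_rank_two_of_apexFacts ha hc n K hcpt 𝔫 lam hn h𝔫 hdom π hT φ hφW hφW' hfix c hcv
  refine ⟨q, TwistedQuotient.coneClass hω (ResGLnCone.hermOne_mem_posCone n K), hne,
    fun v hv i hi => ?_⟩
  exact TwistedQuotient.heckeEnd_coneClass_eq_smul hω (ResGLnCone.hermOne_mem_posCone n K)
    (heig v hv i hi)

/-- **The named fact `ResGLnCohomology.cuspidalEigenclass_exists` (ALL `n ≥ 1`, any `K`) from the two
apex facts**: rank `≥ 2` through `cuspidalEigenclass_rank_two_of_eigenformComparison` (`…ResComparison`,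
Flath + Satake), rank one by the landed `stub_glOne_character` / `stub_glOne_eigenclass`
(`…ResGlOneCharacter`, `…ResGlOneEigenclass`). [cite: Clozel1990, Lemme 3.15 and §3.5]
[cite: FlathCorvallis1979, Thm. 3] [cite: RaghuramShahidi2010, §2.2] -/
theorem cuspidalEigenclass_exists_of_apexFacts
    (ha : ConeDictionary.Clozel1990_exists_basic_levelFixed_cocycle)
    (hc : ConeDictionary.Borel1983_coneClass_ne_zero) :
    ResGLnCohomology.cuspidalEigenclass_exists := by
  intro n K _ _ hcpt 𝔫 lam hn h𝔫 hdom π hT hfix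
  rcases Nat.lt_or_ge n 2 with h2 | h2
  · obtain rfl : n = 1 := by omega
    obtain ⟨χ, hL, hΓ, hSat⟩ := stub_glOne_character K hcpt 𝔫 lam h𝔫 π hT hfix
    obtain ⟨x, hx0, hxT⟩ := stub_glOne_eigenclass K 𝔫 lam χ hL hΓ
    refine ⟨0, x, hx0, fun v hv α hα i hi => ?_⟩
    change heckeOp ℂ 1 K 𝔫 lam 0 (heckeElement 1 K v i) x = _
    rw [hxT, hSat v hv α hα i hi]
  · exact cuspidalEigenclass_rank_two_of_eigenformComparison
      (eigenformComparison_rank_two_of_apexFacts ha hc) n K hcpt 𝔫 lam h2 h𝔫 hdom π hT hfix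

/-- **Clozel's Hecke-field theorem (the Literature named fact `Clozel1990_heckeEigenvalueField`, which
IS the crux verbatim) from the two apex facts**, through `cuspidalEigenclass_exists_of_apexFacts` and the
landed closure `clozel1990_heckeEigenvalueField_of_cuspidalEigenclass` (`…ResFinal`, Borel–Serre being the
theorem `borelSerre1973_finiteDimensional_groupCohomology_congruenceSubgroup_holds`).
[cite: Clozel1990, Thm. 3.13 (proof: Lemme 3.14–3.15 and §3.5, pp. 120–123)] -/
theorem clozel1990_heckeEigenvalueField_of_apexFacts
    (ha : ConeDictionary.Clozel1990_exists_basic_levelFixed_cocycle)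
    (hc : ConeDictionary.Borel1983_coneClass_ne_zero) : Clozel1990_heckeEigenvalueField :=
  clozel1990_heckeEigenvalueField_of_cuspidalEigenclass (cuspidalEigenclass_exists_of_apexFacts ha hc)

/-- **The crux `HeckeEigenvalueField` BY NAME from the two apex facts** (Clozel 1990, Thm. 3.13 for
`GL_n` over any number field `K`): the route decl is the Literature fact verbatim
(`route_heckeEigenvalueField_of_clozel1990`, `…Conditional`), fed with
`clozel1990_heckeEigenvalueField_of_apexFacts`.  Conditional on (a′) and (c′) only (D-0014).
[cite: Clozel1990, Thm. 3.13 (proof: Lemme 3.14–3.15 and §3.5)] [cite: BorelSerre1973, §11.1 (c), Thm. 11.4.4] -/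
theorem heckeEigenvalueField_of_apexFacts
    (ha : ConeDictionary.Clozel1990_exists_basic_levelFixed_cocycle)
    (hc : ConeDictionary.Borel1983_coneClass_ne_zero) :
    Summit.Langlands.Langlands.Theses.IrreducibilityBySelfDuality.HeckeEigenvalueField :=
  route_heckeEigenvalueField_of_clozel1990 (clozel1990_heckeEigenvalueField_of_apexFacts ha hc)

end Summit.Langlands.Langlands.Theorems.HeckeEigenvalueField.Res

end
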